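import Mathlib
import Summits.NavierStokesRegularity.NavierStokesRegularity.Theorems.TaoLadderRungTwoFlatNearBehindAprioriSharp
import Summits.NavierStokesRegularity.NavierStokesRegularity.Theorems.TaoLadderRungTwoFlatInterfaceField
import HarnessLib

/-!
# The JOINT near/behind in-hop a-priori loop with the TOP near-edge input read from the near LEVEL (theory-1 g47/g48 D16,
  TRAP #20 cure) — the near/behind half of the interface loop of record (P-61a)
  (helper for the K_A♭ parent item stmt-NavierStokesRegularity-22987 `FlatGapCertificatesV2`, child 2A `GradedAdiabaticWakeA` of
  route TaoLadderRungTwoFlat; cell harvest/h2-tao-ladder, p1 g24; LADDER §49, §54–§61)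

`…NearBehindAprioriSharp` (D13) bounds the near block's TOP edge input with the crude block amplitude `A` at the top near bond:
`(1+ε)·1·r·(A² + M·r)` — theory-1 NUM-T60 TRAP #20: with the interface level `r` endogenous (§61) this term has loop gain `≈ 16A² ≥ 1`
and kills every schedule. This module re-runs the same continuous induction with the top bond deviation read from the near LEVEL
itself (`MirrorPulse.edgeInput_le_level`): at the top near shell the co-moving weight `e^{−θ_Vσs}` cancels the level's growth
`e^{θ_Vσs}`, so the top summand of the edge input is `1·r·(2V̄_N + ε·r·√(2V̄_N) + (1+ε)·M·r)`; inside the induction the level at time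
`s` is the inducted quantity's own past. Everything else — inputs, outputs, the corollary with both landing clauses (now through the
generic `HopTube.near_hop_of_pseudoFlows`) — is as in `…NearBehindAprioriSharp`.

* `near_behind_apriori_of_pseudoFlows_iface`, `near_behind_hop_of_schedule_iface`.

HONEST FRAMING: inequalities about MODEL-lattice certificate flows (graded mirror table on `S♭`, `m = 2`); the interface levels `r`,
template bounds and scalar schedule inequalities are HYPOTHESES; nothing certified; no item closed; nothing about the
Navier–Stokes equations.
-/

noncomputable section

-- the sub-problem namespace repeats the summit name by design (D-0017)
set_option linter.dupNamespace false

namespace Summit.NavierStokesRegularity.NavierStokesRegularity.Theorems.HopTube.R54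

open Set Finset Literature.Analysis.FluidPDE Literature.Analysis.FluidPDE.TaoCascade MirrorPulse

section Joint

variable {ε ε₀ τ κ₂ κ₂' : ℝ} {W₀ FW₀ BW₀ S₀ FS₀ BS₀ : Fin 2 → ℤ → ℝ} {W FW S FS : Fin 2 → ℤ → ℝ → ℝ}

set_option maxHeartbeats 400000 in
/-- **THE JOINT NEAR/BEHIND IN-HOP A-PRIORI LOOP, top near-edge input read from the near LEVEL** (theory-1 D16, TRAP #20
cure): as `near_behind_apriori_of_pseudoFlows_sharp` with the top summand of the near edge input
`1·r·(2V̄_N + ε·r·√(2V̄_N) + (1+ε)·M·r)` in place of `(1+ε)·1·r·(A² + M·r)`. See the module docstring.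
[cite: Tao2016AveragedNS, §4 (4.1), (4.3), (4.5), (4.8), §5 (continuity argument, statement shape); route TaoLadderRungTwoFlat, L8b + R54-1 joint loop + D16 (cell LADDER §49.5, §54.8–54.9, §60.7, §61)] -/
theorem near_behind_apriori_of_pseudoFlows_iface
    (hW : PseudoFlowOnShift shiftSetFlat τ ε₀ (mirrorTable ε ε) 0 κ₂ W₀ FW₀ BW₀ W FW)
    (hS : PseudoFlowOnShift shiftSetFlat τ ε₀ (mirrorTable ε ε) 0 κ₂' S₀ FS₀ BS₀ S FS)
    (hε : 0 ≤ ε) (hε₀ : 0 < ε₀) {K D : ℕ} (hDK : K + 1 ≤ D)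
    {θV θ' σ τ₁ Aeff A A₀ A₁ M M₁ r μN μB V₀N V₀B VbarN VbarB : ℝ}
    (hθV : 0 ≤ θV) (hθ : 0 ≤ θ') (hθ5 : θ' ≤ 5 * Real.log (1 + ε₀)) (hAeff : 0 < Aeff)
    (hτ₁ : 0 < τ₁) (hτ₁τ : τ₁ ≤ τ) (hστ : σ * τ₁ = 1)
    (hM0 : 0 ≤ M) (hM : ∀ t ∈ Icc 0 τ₁, ∀ i, ∀ m ∈ Finset.Icc (-(D : ℤ)) (1 - (K : ℤ)), |W i m t| ≤ M)
    (hM₁ : ∀ t ∈ Icc 0 τ₁, |W 1 (-(K : ℤ)) t| ≤ M₁)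
    (hr : ∀ t ∈ Icc 0 τ₁, ∀ i, |(S - W) i (1 - (K : ℤ)) t| ≤ r) (hr0 : 0 ≤ r) (hVN0 : 0 ≤ VbarN)
    (hAdef : A = Real.sqrt (2 * VbarB) * Real.exp (θ' / 2) * Real.exp (θ' * ((D : ℝ) - K) / 2) + M)
    (hA₀def : A₀ = M + r)
    (hA₁def : A₁ = M₁ + Real.sqrt (2 * VbarN) * Real.exp (θV / 2))
    (hrA : r ≤ A) (hA₀le : A₀ ≤ Aeff)
    (hV₀N : coMovingEnergyOn (Finset.Icc (1 - (D : ℤ)) (-(K : ℤ))) θV (-(K : ℝ)) (S - W) 0 ≤ V₀N)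
    (hV₀B : ∀ L : ℕ, coMovingEnergyOn (Finset.Icc (1 - (K : ℤ) - L) (-(K : ℤ))) θ' (-(K : ℝ)) S 0 ≤ V₀B)
    (hμN : 0 < μN)
    (hμNle : μN ≤ σ * θV - 2 * (1 + ε) * 1 * (A * Real.sinh (θV / 2) + M * (3 + Real.exp θV)))
    (hμB : 0 < μB) (hμBle : μB ≤ σ * θ' - 2 * (1 + ε) * Aeff * Real.sinh (θ' / 2))
    (hlevN : V₀N + (Real.exp (θV * ((1 : ℝ) - D + K)) * ((1 + ε) * 1 * A ^ 2 * (A + M))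
        + 1 * r * (2 * VbarN + ε * r * Real.sqrt (2 * VbarN) + (1 + ε) * M * r)) * τ₁ < VbarN)
    (hlevB : V₀B + A₁ * A₀ * (A₁ + ε * A₀) * τ₁ < VbarB)
    (hclose : Real.sqrt (2 * VbarB) * Real.exp (θ' / 2) ≤ Aeff) :
    (∀ t ∈ Icc 0 τ₁, ∀ n : ℤ, n ≤ -(K : ℤ) →
        clock ε₀ n * |S 1 n t| ≤ Aeff ∧ clock ε₀ n * |S 0 (n + 1) t| ≤ Aeff) ∧
      (∀ t ∈ Icc 0 τ₁, ∀ i, ∀ m ∈ Finset.Icc (-(D : ℤ)) (1 - (K : ℤ)), |(S - W) i m t| ≤ A) ∧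
      (∀ t ∈ Icc 0 τ₁,
        coMovingEnergyOn (Finset.Icc (1 - (D : ℤ)) (-(K : ℤ))) θV (-(K : ℝ) + σ * t) (S - W) t ≤ VbarN) ∧
      (∀ t ∈ Icc 0 τ₁, |S 1 (-(K : ℤ)) t| ≤ A₁) := by
  subst hAdef hA₀def hA₁def
  have hσ : 0 < σ := pos_of_mul_pos_left (by rw [hστ]; exact one_pos) hτ₁.le
  have hε₀' : (-1 : ℝ) ≤ ε₀ := by linarith
  have haP : (1 - (D : ℤ)) ≤ -(K : ℤ) := by
    have : ((K + 1 : ℕ) : ℤ) ≤ (D : ℤ) := by exact_mod_cast hDK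
    push_cast at this; omega
  -- abbreviations (the statement spells them out through `hAdef`, `hA₀def`, `hA₁def`)
  set A : ℝ := Real.sqrt (2 * VbarB) * Real.exp (θ' / 2) * Real.exp (θ' * ((D : ℝ) - K) / 2) + M with hAdef
  set A₀ : ℝ := M + r with hA₀def
  set A₁ : ℝ := M₁ + Real.sqrt (2 * VbarN) * Real.exp (θV / 2) with hA₁def
  have hApos : 0 ≤ A := hr0.trans hrA
  have hA₀0 : 0 ≤ A₀ := by rw [hA₀def]; positivity
  -- the near edge input
  set EN : ℝ := Real.exp (θV * ((1 : ℝ) - D + K)) * ((1 + ε) * 1 * A ^ 2 * (A + M))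
      + 1 * r * (2 * VbarN + ε * r * Real.sqrt (2 * VbarN) + (1 + ε) * M * r) with hENdef
  have hEN0 : 0 ≤ EN := by positivity
  have hEtop0 : 0 ≤ A₁ * A₀ * (A₁ + ε * A₀) := by
    have hA₁0 : 0 ≤ A₁ := by
      rw [hA₁def]
      have := (abs_nonneg _).trans (hM₁ 0 ⟨le_rfl, hτ₁.le⟩)
      positivity
    positivity
  -- the core's bottom carrier during the hop: `|a_{1−K}| ≤ M + r = A₀`
  have hA₀ : ∀ t ∈ Icc 0 τ₁, |S 0 (-(K : ℤ) + 1) t| ≤ A₀ := fun t ht => coreBottom_amp_le hDK (hM t ht) (hr t ht)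
  -- STEP A: a near-energy level `≤ V̄_N` on `[0, t]` gives the behind clock-weighted bound on `[0, t]`
  --         (the behind bootstrap on the initial segment, co-moving speed `1/t`)
  have stepA : ∀ t ∈ Icc 0 τ₁, 0 < t →
      (∀ s ∈ Icc 0 t, coMovingEnergyOn (Finset.Icc (1 - (D : ℤ)) (-(K : ℤ))) θV (-(K : ℝ) + σ * s) (S - W) s
        ≤ VbarN) →
      (∀ s ∈ Icc 0 t, ∀ n : ℤ, n ≤ -(K : ℤ) →
        clock ε₀ n * |S 1 n s| ≤ Aeff ∧ clock ε₀ n * |S 0 (n + 1) s| ≤ Aeff) ∧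
      (∀ s ∈ Icc 0 t, ∀ i, ∀ m ∈ Finset.Icc (-(D : ℤ)) (1 - (K : ℤ)), |(S - W) i m s| ≤ A) := by
    intro t ht htpos hpast
    have htτ : t ≤ τ := ht.2.trans hτ₁τ
    have hσ't : (1 / t) * t = 1 := by field_simp
    -- interface amplitude on `[0, t]`
    have hA₁ : ∀ s ∈ Ioo 0 t, |S 1 (-(K : ℤ)) s| ≤ A₁ := by
      intro s hs
      have hs' : s ∈ Icc 0 t := ⟨hs.1.le, hs.2.le⟩
      have hσs : σ * s ≤ 1 := by
        calc σ * s ≤ σ * τ₁ := mul_le_mul_of_nonneg_left (hs.2.le.trans ht.2) hσ.le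
          _ = 1 := hστ
      exact interface_amp_of_nearEnergy hθV hDK hσs (hpast s hs') (hM₁ s ⟨hs.1.le, hs.2.le.trans ht.2⟩)
    have ht0 : (0 : ℝ) ≤ 1 / t := by positivity
    have hEtop : ∀ s ∈ Ioo 0 t,
        Real.exp (θ' * ((((-(K : ℤ)) : ℤ) : ℝ) - (-(K : ℝ) + (1 / t) * s))) * |fluxT ε ε₀ S (-(K : ℤ)) s|
          ≤ A₁ * A₀ * (A₁ + ε * A₀) := fun s hs =>
      weighted_topFlux_le hε hε₀.le hθ K S (mul_nonneg ht0 hs.1.le) (hA₁ s hs)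
        (hA₀ s ⟨hs.1.le, hs.2.le.trans ht.2⟩)
    have h1t : σ ≤ 1 / t := by
      rw [le_div_iff₀ htpos]
      calc σ * t ≤ σ * τ₁ := mul_le_mul_of_nonneg_left ht.2 hσ.le
        _ = 1 := hστ
    have hμB' : μB ≤ (1 / t) * θ' - 2 * (1 + ε) * Aeff * Real.sinh (θ' / 2) := by
      have h2 : σ * θ' ≤ (1 / t) * θ' := mul_le_mul_of_nonneg_right h1t hθ
      linarith
    have hlev' : V₀B + A₁ * A₀ * (A₁ + ε * A₀) * t < VbarB := by
      have h3 : A₁ * A₀ * (A₁ + ε * A₀) * t ≤ A₁ * A₀ * (A₁ + ε * A₀) * τ₁ :=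
        mul_le_mul_of_nonneg_left ht.2 hEtop0
      linarith
    have hA₀' : ∀ s ∈ Icc 0 t, |S 0 (-(K : ℤ) + 1) s| ≤ A₀ := fun s hs => hA₀ s ⟨hs.1, hs.2.trans ht.2⟩
    have hbd := behind_apriori_of_pseudoFlow_sharp (σ := 1 / t) (τ₁ := t) (Etop := A₁ * A₀ * (A₁ + ε * A₀))
      (V₀ := V₀B) (Vbar := VbarB) hS hε hε₀ hθ hθ5 hAeff htpos htτ hσ't hA₀' hA₀le hEtop hEtop0 hV₀B hμB hμB'
      hlev' hclose
    refine ⟨hbd, fun s hs i m hm => ?_⟩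
    -- the behind block `[−D, −K]` (`L = D + 1 − K`) DURING the hop, read on the near shells (D13)
    have hEn := behind_blockEnergy_le_of_apriori (σ := 1 / t) (τ₁ := t) hS hε hε₀ hθ hAeff.le ht0 htτ hbd hEtop
      hEtop0 hV₀B hμB hμB' (D + 1 - K) hs
    have eL : (1 - (K : ℤ) - ((D + 1 - K : ℕ) : ℤ)) = -(D : ℤ) := by
      rw [Nat.cast_sub (by omega : K ≤ D + 1)]; push_cast; ring
    rw [eL] at hEn
    have hlev : V₀B + A₁ * A₀ * (A₁ + ε * A₀) * s ≤ VbarB := by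
      have h3 : A₁ * A₀ * (A₁ + ε * A₀) * s ≤ A₁ * A₀ * (A₁ + ε * A₀) * τ₁ :=
        mul_le_mul_of_nonneg_left (hs.2.trans ht.2) hEtop0
      linarith
    have hσs1 : 1 / t * s ≤ 1 := by
      rw [one_div, inv_mul_le_iff₀ htpos]; linarith [hs.2]
    exact near_deviation_amp_of_blockEnergy hθ hσs1 (hEn.trans hlev) (hM s ⟨hs.1, hs.2.trans ht.2⟩)
      (hr s ⟨hs.1, hs.2.trans ht.2⟩) hrA i hm
  -- STEP B: continuous induction on the near deviation energy
  have hcont : ContinuousOn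
      (fun t => coMovingEnergyOn (Finset.Icc (1 - (D : ℤ)) (-(K : ℤ))) θV (-(K : ℝ) + σ * t) (S - W) t)
      (Icc 0 τ₁) := by
    refine continuousOn_coMovingEnergyOn _ fun i n _ => ?_
    have hS' := (QuadPolar.continuousOn_of_pseudoFlowOnShift hS i n).mono (Icc_subset_Icc le_rfl hτ₁τ)
    have hW' := (QuadPolar.continuousOn_of_pseudoFlowOnShift hW i n).mono (Icc_subset_Icc le_rfl hτ₁τ)
    have e : (S - W) i n = fun s => S i n s - W i n s := by funext s; simp
    rw [e]; exact hS'.sub hW'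
  set ηN : ℝ := (VbarN - (V₀N + EN * τ₁)) / 2 with hηNdef
  have hηN0 : 0 < ηN := by rw [hηNdef]; linarith
  have hba : V₀N + EN * τ₁ + ηN < VbarN := by rw [hηNdef]; linarith
  have h0 : coMovingEnergyOn (Finset.Icc (1 - (D : ℤ)) (-(K : ℤ))) θV (-(K : ℝ) + σ * 0) (S - W) 0
      ≤ V₀N + EN * τ₁ + ηN := by
    rw [mul_zero, add_zero]
    have : 0 ≤ EN * τ₁ := by positivity
    linarith
  have key := Bootstrap.Icc_induction (T := τ₁) (a := VbarN) (b := V₀N + EN * τ₁ + ηN) hτ₁.le hcont hba h0 ?_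
  · -- conclusions
    have hnear : ∀ t ∈ Icc 0 τ₁,
        coMovingEnergyOn (Finset.Icc (1 - (D : ℤ)) (-(K : ℤ))) θV (-(K : ℝ) + σ * t) (S - W) t ≤ VbarN :=
      fun t ht => (key t ht).trans hba.le
    obtain ⟨hbd, hAmpτ⟩ := stepA τ₁ ⟨hτ₁.le, le_rfl⟩ hτ₁ hnear
    refine ⟨hbd, hAmpτ, hnear, fun t ht => ?_⟩
    · have hσt : σ * t ≤ 1 := by
        calc σ * t ≤ σ * τ₁ := mul_le_mul_of_nonneg_left ht.2 hσ.le
          _ = 1 := hστ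
      exact interface_amp_of_nearEnergy hθV hDK hσt (hnear t ht) (hM₁ t ht)
  · -- the step
    intro t ht hpast
    rcases eq_or_lt_of_le ht.1 with h0t | htpos
    · rw [← h0t]; exact h0
    -- behind clock-weighted bound on `[0, t]`, then the near deviation amplitude there
    obtain ⟨-, hAmpIcc⟩ := stepA t ht htpos hpast
    have hAmp : ∀ s ∈ Ioo 0 t, ∀ i, ∀ m ∈ Finset.Icc (1 - (D : ℤ) - 1) (-(K : ℤ) + 1), |(S - W) i m s| ≤ A := by
      intro s hs i m hm
      have hm' : m ∈ Finset.Icc (-(D : ℤ)) (1 - (K : ℤ)) := by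
        simp only [Finset.mem_Icc] at hm ⊢; omega
      exact hAmpIcc s ⟨hs.1.le, hs.2.le⟩ i m hm'
    have hM' : ∀ s ∈ Ioo 0 t, ∀ i, ∀ m ∈ Finset.Icc (1 - (D : ℤ) - 1) (-(K : ℤ) + 1), |W i m s| ≤ M := by
      intro s hs i m hm
      refine hM s ⟨hs.1.le, hs.2.le.trans ht.2⟩ i m ?_
      simp only [Finset.mem_Icc] at hm ⊢; omega
    have hc' : ∀ m ∈ Finset.Icc (1 - (D : ℤ) - 1) (-(K : ℤ)), clock ε₀ m ≤ 1 := by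
      intro m hm
      simp only [Finset.mem_Icc] at hm
      exact clock_le_one_of_nonpos hε₀.le (by omega)
    -- the near edge input on `(0, t)`
    have hE : ∀ s ∈ Ioo 0 t,
        Real.exp (θV * (((1 - (D : ℤ) : ℤ) : ℝ) - (-(K : ℝ) + σ * s))) * |fluxT ε ε₀ (S - W) (1 - (D : ℤ) - 1) s|
          + Real.exp (θV * (((-(K : ℤ) : ℤ) : ℝ) - (-(K : ℝ) + σ * s))) * |fluxT ε ε₀ (S - W) (-(K : ℤ)) s|
          + (1 + ε) * 1 * M *
            (Real.exp (θV * (((1 - (D : ℤ) : ℤ) : ℝ) - (-(K : ℝ) + σ * s))) * (S - W) 1 (1 - (D : ℤ) - 1) s ^ 2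
              + Real.exp (θV * (((-(K : ℤ) : ℤ) : ℝ) - (-(K : ℝ) + σ * s))) * (S - W) 0 (-(K : ℤ) + 1) s ^ 2)
          ≤ EN := by
      intro s hs
      have hs'' : s ∈ Icc 0 τ₁ := ⟨hs.1.le, hs.2.le.trans ht.2⟩
      have hσs : 0 ≤ σ * s := (mul_pos hσ hs.1).le
      have hqa : |(S - W) 1 (1 - (D : ℤ) - 1) s| ≤ A := hAmp s hs 1 _ (by simp only [Finset.mem_Icc]; omega)
      have hpa : |(S - W) 0 (1 - (D : ℤ)) s| ≤ A := hAmp s hs 0 _ (by simp only [Finset.mem_Icc]; omega)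
      -- the top near bond read from the LEVEL (D16): `e^{θ(P − n_e)}·q_P² ≤ 2·V(s) ≤ 2·V̄_N`
      have hνP : Real.exp (θV * ((((-(K : ℤ)) : ℤ) : ℝ) - (-(K : ℝ) + σ * s))) * |(S - W) 1 (-(K : ℤ)) s| ^ 2
          ≤ 2 * VbarN := by
        have hmem : (-(K : ℤ)) ∈ Finset.Icc (1 - (D : ℤ)) (-(K : ℤ)) := Finset.mem_Icc.mpr ⟨haP, le_rfl⟩
        have h1 := sq_le_exp_mul_coMovingEnergyOn (Finset.Icc (1 - (D : ℤ)) (-(K : ℤ))) θV (-(K : ℝ) + σ * s)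
          (S - W) s hmem 1
        have hV := hpast s ⟨hs.1.le, hs.2.le⟩
        have hφ : Real.exp (θV * ((((-(K : ℤ)) : ℤ) : ℝ) - (-(K : ℝ) + σ * s)))
            * Real.exp (θV * ((-(K : ℝ) + σ * s) - (((-(K : ℤ)) : ℤ) : ℝ))) = 1 := by
          rw [← Real.exp_add]; convert Real.exp_zero using 2; ring
        have hφ0 : 0 ≤ Real.exp (θV * ((((-(K : ℤ)) : ℤ) : ℝ) - (-(K : ℝ) + σ * s))) := (Real.exp_pos _).le
        rw [sq_abs]
        calc Real.exp (θV * ((((-(K : ℤ)) : ℤ) : ℝ) - (-(K : ℝ) + σ * s))) * (S - W) 1 (-(K : ℤ)) s ^ 2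
            = 2 * (Real.exp (θV * ((((-(K : ℤ)) : ℤ) : ℝ) - (-(K : ℝ) + σ * s))) * ((S - W) 1 (-(K : ℤ)) s ^ 2 / 2)) := by
              ring
          _ ≤ 2 * (Real.exp (θV * ((((-(K : ℤ)) : ℤ) : ℝ) - (-(K : ℝ) + σ * s)))
              * (Real.exp (θV * ((-(K : ℝ) + σ * s) - (((-(K : ℤ)) : ℤ) : ℝ)))
                * coMovingEnergyOn (Finset.Icc (1 - (D : ℤ)) (-(K : ℤ))) θV (-(K : ℝ) + σ * s) (S - W) s)) := by
              gcongr
          _ = 2 * ((Real.exp (θV * ((((-(K : ℤ)) : ℤ) : ℝ) - (-(K : ℝ) + σ * s)))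
              * Real.exp (θV * ((-(K : ℝ) + σ * s) - (((-(K : ℤ)) : ℤ) : ℝ))))
                * coMovingEnergyOn (Finset.Icc (1 - (D : ℤ)) (-(K : ℤ))) θV (-(K : ℝ) + σ * s) (S - W) s) := by ring
          _ = 2 * coMovingEnergyOn (Finset.Icc (1 - (D : ℤ)) (-(K : ℤ))) θV (-(K : ℝ) + σ * s) (S - W) s := by
              rw [hφ, one_mul]
          _ ≤ 2 * VbarN := by linarith
      have hr' : |(S - W) 0 (-(K : ℤ) + 1) s| ≤ r := by
        have e1 : (-(K : ℤ) + 1) = 1 - (K : ℤ) := by ring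
        rw [e1]; exact hr s hs'' 0
      have hPne : (((-(K : ℤ)) : ℤ) : ℝ) ≤ -(K : ℝ) + σ * s := by push_cast; linarith
      have hca : clock ε₀ (1 - (D : ℤ) - 1) ≤ 1 := clock_le_one_of_nonpos hε₀.le (by omega)
      have hcP : clock ε₀ (-(K : ℤ)) ≤ 1 := clock_le_one_of_nonpos hε₀.le (by omega)
      have hedge := edgeInput_le_level (θ := θV) (ne := -(K : ℝ) + σ * s) hε hε₀' hθV hM0 zero_le_one (S - W) s hPne
        hqa hpa le_rfl hνP hr' hca hcP
      refine hedge.trans ?_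
      have hX : 0 ≤ (1 + ε) * 1 * A ^ 2 * (A + M) := by positivity
      have hw : Real.exp (θV * ((((1 - (D : ℤ)) : ℤ) : ℝ) - (-(K : ℝ) + σ * s)))
          ≤ Real.exp (θV * ((1 : ℝ) - D + K)) := by
        rw [Real.exp_le_exp]
        push_cast
        exact mul_le_mul_of_nonneg_left (by linarith) hθV
      rw [hENdef]
      linarith [mul_le_mul_of_nonneg_right hw hX]
    have htr := coMovingEnergyOn_decay_of_pseudoFlows (n₀ := -(K : ℝ)) (σ := σ) (θ := θV) hW hS hε hε₀' hθV
      haP le_rfl ht.1 (ht.2.trans hτ₁τ) hAmp hM' hc' hE hμN hμNle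
    rw [sub_zero, mul_zero, add_zero] at htr
    have he1 : Real.exp (-μN * t) ≤ 1 := by
      rw [Real.exp_le_one_iff]
      have := mul_nonneg hμN.le ht.1
      linarith
    have hf0 : 0 ≤ coMovingEnergyOn (Finset.Icc (1 - (D : ℤ)) (-(K : ℤ))) θV (-(K : ℝ)) (S - W) 0 :=
      coMovingEnergyOn_nonneg _ _ _ _ _
    have hexp : (1 - Real.exp (-μN * t)) / μN ≤ t := by
      rw [div_le_iff₀ hμN]
      have := Real.add_one_le_exp (-μN * t)
      linarith
    have hI : EN * (1 - Real.exp (-μN * t)) / μN ≤ EN * τ₁ := by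
      rw [mul_div_assoc]
      exact mul_le_mul_of_nonneg_left (hexp.trans ht.2) hEN0
    calc coMovingEnergyOn (Finset.Icc (1 - (D : ℤ)) (-(K : ℤ))) θV (-(K : ℝ) + σ * t) (S - W) t
        ≤ Real.exp (-μN * t) * coMovingEnergyOn (Finset.Icc (1 - (D : ℤ)) (-(K : ℤ))) θV (-(K : ℝ)) (S - W) 0
            + EN * (1 - Real.exp (-μN * t)) / μN := htr
      _ ≤ 1 * V₀N + EN * τ₁ := add_le_add (mul_le_mul he1 hV₀N hf0 zero_le_one) hI
      _ ≤ V₀N + EN * τ₁ + ηN := by linarith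

/-- **THE NEAR AND BEHIND HOPS CLOSED MODULO THE INTERFACE LEVEL `r` AND THE NAMED SCHEDULE HYPOTHESES (D16 top input).**
The joint a-priori loop
discharges the in-hop hypotheses `hA`, `hE` of `HopTube.near_hop_of_pseudoFlows` and `hbd`/`hEtop` of
`R54.behindEnergyClause_hop_topInput`: from the template bounds, the core inputs `r`, the initial levels, the two rates,
the three closing inequalities, the near template residual `R_T` and the two budgets, the re-centred landing state satisfies
`NearClause (n+1)` AND `BehindEnergyClause K θ′ W′`.
[cite: Tao2016AveragedNS, §4 (4.1), (4.3), (4.5), (4.8), §6.3–6.4 (statement shape); route TaoLadderRungTwoFlat, `HopTube.TubeStepNear` + R54-1 behind (cell LADDER §49, §54–§56, referee c88 W-25)] -/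
theorem near_behind_hop_of_schedule_iface (P : TubeSchedule) {i₀ : Fin 2} {ustar : Fin 2 → ℤ → ℝ}
    (hW : PseudoFlowOnShift shiftSetFlat τ ε₀ (mirrorTable ε ε) 0 κ₂ W₀ FW₀ BW₀ W FW)
    (hS : PseudoFlowOnShift shiftSetFlat τ ε₀ (mirrorTable ε ε) 0 κ₂' S₀ FS₀ BS₀ S FS)
    (hε : 0 ≤ ε) (hε₀ : 0 < ε₀) (hDK : P.K + 1 ≤ P.D)
    {θ' σ τ₁ a Aeff A A₀ A₁ M M₁ r μN μB V₀N V₀B VbarN VbarB RT W' : ℝ} {n : ℕ}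
    (hθV : 0 ≤ P.θV) (hθ : 0 ≤ θ') (hθ5 : θ' ≤ 5 * Real.log (1 + ε₀)) (hAeff : 0 < Aeff)
    (hτ₁ : 0 < τ₁) (hτ₁τ : τ₁ ≤ τ) (hστ : σ * τ₁ = 1) (ha : 0 < a)
    (hM0 : 0 ≤ M) (hM : ∀ t ∈ Icc 0 τ₁, ∀ i, ∀ m ∈ Finset.Icc (-(P.D : ℤ)) (1 - (P.K : ℤ)), |W i m t| ≤ M)
    (hM₁ : ∀ t ∈ Icc 0 τ₁, |W 1 (-(P.K : ℤ)) t| ≤ M₁)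
    (hr : ∀ t ∈ Icc 0 τ₁, ∀ i, |(S - W) i (1 - (P.K : ℤ)) t| ≤ r) (hr0 : 0 ≤ r) (hVN0 : 0 ≤ VbarN)
    (hAdef : A = Real.sqrt (2 * VbarB) * Real.exp (θ' / 2) * Real.exp (θ' * ((P.D : ℝ) - P.K) / 2) + M)
    (hA₀def : A₀ = M + r)
    (hA₁def : A₁ = M₁ + Real.sqrt (2 * VbarN) * Real.exp (P.θV / 2))
    (hrA : r ≤ A) (hA₀le : A₀ ≤ Aeff)
    (hV₀N : coMovingEnergyOn (Finset.Icc (1 - (P.D : ℤ)) (-(P.K : ℤ))) P.θV (-(P.K : ℝ)) (S - W) 0 ≤ V₀N)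
    (hV₀B : ∀ L : ℕ, coMovingEnergyOn (Finset.Icc (1 - (P.K : ℤ) - L) (-(P.K : ℤ))) θ' (-(P.K : ℝ)) S 0 ≤ V₀B)
    (hμN : 0 < μN)
    (hμNle : μN ≤ σ * P.θV - 2 * (1 + ε) * 1 * (A * Real.sinh (P.θV / 2) + M * (3 + Real.exp P.θV)))
    (hμB : 0 < μB) (hμBle : μB ≤ σ * θ' - 2 * (1 + ε) * Aeff * Real.sinh (θ' / 2))
    (hlevN : V₀N + (Real.exp (P.θV * ((1 : ℝ) - P.D + P.K)) * ((1 + ε) * 1 * A ^ 2 * (A + M))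
        + 1 * r * (2 * VbarN + ε * r * Real.sqrt (2 * VbarN) + (1 + ε) * M * r)) * τ₁ < VbarN)
    (hlevB : V₀B + A₁ * A₀ * (A₁ + ε * A₀) * τ₁ < VbarB)
    (hclose : Real.sqrt (2 * VbarB) * Real.exp (θ' / 2) ≤ Aeff)
    (hR : ∑ k ∈ Finset.Icc (-(P.D : ℤ)) (-(P.K : ℤ) - 1), Real.exp (P.θV * ((k : ℝ) + P.K)) *
        ∑ i : Fin 2, (W i (1 + k) τ₁ - |S i₀ 1 τ₁| / P.Astar * ustar i k) ^ 2 / 2 ≤ RT)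
    (hbudgetN : (Real.sqrt (Real.exp (-μN * τ₁) * V₀N +
        (Real.exp (P.θV * ((1 : ℝ) - P.D + P.K)) * ((1 + ε) * 1 * A ^ 2 * (A + M)) + 1 * r * (2 * VbarN + ε * r * Real.sqrt (2 * VbarN) + (1 + ε) * M * r))
          * (1 - Real.exp (-μN * τ₁)) / μN) + Real.sqrt RT) ^ 2 ≤ a ^ 2 * P.v (n + 1))
    (hbudgetB : Real.exp (-μB * τ₁) * V₀B + A₁ * A₀ * (A₁ + ε * A₀) * (1 - Real.exp (-μB * τ₁)) / μB
        ≤ a ^ 2 * W') :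
    NearClause P i₀ ustar (n + 1) (recentre S τ₁ a) ∧ BehindEnergyClause P.K θ' W' (recentre S τ₁ a) := by
  have hσ : 0 < σ := pos_of_mul_pos_left (by rw [hστ]; exact one_pos) hτ₁.le
  have hε₀' : (-1 : ℝ) ≤ ε₀ := by linarith
  have haP : (1 - (P.D : ℤ)) ≤ -(P.K : ℤ) := by
    have : ((P.K + 1 : ℕ) : ℤ) ≤ (P.D : ℤ) := by exact_mod_cast hDK
    push_cast at this; omega
  obtain ⟨hbd, hAmp, hnear, hA₁⟩ := near_behind_apriori_of_pseudoFlows_iface hW hS hε hε₀ hDK hθV hθ hθ5 hAeff hτ₁ hτ₁τ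
    hστ hM0 hM hM₁ hr hr0 hVN0 hAdef hA₀def hA₁def hrA hA₀le hV₀N hV₀B hμN hμNle hμB hμBle hlevN hlevB hclose
  have hA0 : 0 ≤ A := hr0.trans hrA
  refine ⟨?_, ?_⟩
  · refine near_hop_of_pseudoFlows P hW hS hε hε₀.le hθV hDK hτ₁ hτ₁τ hστ ha
      (fun t ht => hAmp t ⟨ht.1.le, ht.2.le⟩) (fun t ht => hM t ⟨ht.1.le, ht.2.le⟩) ?_ hμN hμNle hV₀N hR hbudgetN
    -- the near edge input on `(0, τ₁)`, top bond read from the level (D16)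
    intro s hs
    have hs'' : s ∈ Icc 0 τ₁ := ⟨hs.1.le, hs.2.le⟩
    have hσs : 0 ≤ σ * s := (mul_pos hσ hs.1).le
    have hqa : |(S - W) 1 (1 - (P.D : ℤ) - 1) s| ≤ A :=
      hAmp s hs'' 1 _ (by simp only [Finset.mem_Icc]; omega)
    have hpa : |(S - W) 0 (1 - (P.D : ℤ)) s| ≤ A := hAmp s hs'' 0 _ (by simp only [Finset.mem_Icc]; omega)
    have hνP : Real.exp (P.θV * ((((-(P.K : ℤ)) : ℤ) : ℝ) - (-(P.K : ℝ) + σ * s))) * |(S - W) 1 (-(P.K : ℤ)) s| ^ 2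
        ≤ 2 * VbarN := by
      have hmem : (-(P.K : ℤ)) ∈ Finset.Icc (1 - (P.D : ℤ)) (-(P.K : ℤ)) := Finset.mem_Icc.mpr ⟨haP, le_rfl⟩
      have h1 := sq_le_exp_mul_coMovingEnergyOn (Finset.Icc (1 - (P.D : ℤ)) (-(P.K : ℤ))) P.θV (-(P.K : ℝ) + σ * s)
        (S - W) s hmem 1
      have hV := hnear s hs''
      have hφ : Real.exp (P.θV * ((((-(P.K : ℤ)) : ℤ) : ℝ) - (-(P.K : ℝ) + σ * s)))
          * Real.exp (P.θV * ((-(P.K : ℝ) + σ * s) - (((-(P.K : ℤ)) : ℤ) : ℝ))) = 1 := by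
        rw [← Real.exp_add]; convert Real.exp_zero using 2; ring
      rw [sq_abs]
      calc Real.exp (P.θV * ((((-(P.K : ℤ)) : ℤ) : ℝ) - (-(P.K : ℝ) + σ * s))) * (S - W) 1 (-(P.K : ℤ)) s ^ 2
          = 2 * (Real.exp (P.θV * ((((-(P.K : ℤ)) : ℤ) : ℝ) - (-(P.K : ℝ) + σ * s)))
              * ((S - W) 1 (-(P.K : ℤ)) s ^ 2 / 2)) := by ring
        _ ≤ 2 * (Real.exp (P.θV * ((((-(P.K : ℤ)) : ℤ) : ℝ) - (-(P.K : ℝ) + σ * s)))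
            * (Real.exp (P.θV * ((-(P.K : ℝ) + σ * s) - (((-(P.K : ℤ)) : ℤ) : ℝ)))
              * coMovingEnergyOn (Finset.Icc (1 - (P.D : ℤ)) (-(P.K : ℤ))) P.θV (-(P.K : ℝ) + σ * s) (S - W) s)) := by
            gcongr
        _ = 2 * ((Real.exp (P.θV * ((((-(P.K : ℤ)) : ℤ) : ℝ) - (-(P.K : ℝ) + σ * s)))
            * Real.exp (P.θV * ((-(P.K : ℝ) + σ * s) - (((-(P.K : ℤ)) : ℤ) : ℝ))))
              * coMovingEnergyOn (Finset.Icc (1 - (P.D : ℤ)) (-(P.K : ℤ))) P.θV (-(P.K : ℝ) + σ * s) (S - W) s) := by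
            ring
        _ = 2 * coMovingEnergyOn (Finset.Icc (1 - (P.D : ℤ)) (-(P.K : ℤ))) P.θV (-(P.K : ℝ) + σ * s) (S - W) s := by
            rw [hφ, one_mul]
        _ ≤ 2 * VbarN := by linarith
    have hr' : |(S - W) 0 (-(P.K : ℤ) + 1) s| ≤ r := by
      have e1 : (-(P.K : ℤ) + 1) = 1 - (P.K : ℤ) := by ring
      rw [e1]; exact hr s hs'' 0
    have hPne : (((-(P.K : ℤ)) : ℤ) : ℝ) ≤ -(P.K : ℝ) + σ * s := by push_cast; linarith
    have hca : clock ε₀ (1 - (P.D : ℤ) - 1) ≤ 1 := clock_le_one_of_nonpos hε₀.le (by omega)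
    have hcP : clock ε₀ (-(P.K : ℤ)) ≤ 1 := clock_le_one_of_nonpos hε₀.le (by omega)
    have hedge := edgeInput_le_level (θ := P.θV) (ne := -(P.K : ℝ) + σ * s) hε hε₀' hθV hM0 zero_le_one (S - W) s
      hPne hqa hpa le_rfl hνP hr' hca hcP
    refine hedge.trans ?_
    have hX : 0 ≤ (1 + ε) * 1 * A ^ 2 * (A + M) := by positivity
    have hw : Real.exp (P.θV * ((((1 - (P.D : ℤ)) : ℤ) : ℝ) - (-(P.K : ℝ) + σ * s)))
        ≤ Real.exp (P.θV * ((1 : ℝ) - P.D + P.K)) := by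
      rw [Real.exp_le_exp]
      push_cast
      exact mul_le_mul_of_nonneg_left (by linarith) hθV
    linarith [mul_le_mul_of_nonneg_right hw hX]
  · have hA₀ : ∀ t ∈ Icc 0 τ₁, |S 0 (-(P.K : ℤ) + 1) t| ≤ A₀ := fun t ht => by
      rw [hA₀def]; exact coreBottom_amp_le hDK (hM t ht) (hr t ht)
    have hEtop : ∀ t ∈ Ioo 0 τ₁,
        Real.exp (θ' * ((((-(P.K : ℤ)) : ℤ) : ℝ) - (-(P.K : ℝ) + σ * t))) * |fluxT ε ε₀ S (-(P.K : ℤ)) t|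
          ≤ A₁ * A₀ * (A₁ + ε * A₀) := fun t ht =>
      weighted_topFlux_le hε hε₀.le hθ P.K S (mul_pos hσ ht.1).le (hA₁ t ⟨ht.1.le, ht.2.le⟩)
        (hA₀ t ⟨ht.1.le, ht.2.le⟩)
    exact behindEnergyClause_hop_topInput hS hε hε₀ hθ hAeff.le hτ₁ hτ₁τ hστ ha
      (fun t ht n hn => hbd t ⟨ht.1.le, ht.2.le⟩ n hn) hEtop hV₀B hbudgetB hμB hμBle

end Joint

end Summit.NavierStokesRegularity.NavierStokesRegularity.Theorems.HopTube.R54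

end
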